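import Summits.BirchSwinnertonDyer.BirchSwinnertonDyer.Theorems.GenusKolyvaginAtTwoMinimalTwinBSDTwoSwappedPairSandwich
import Summits.BirchSwinnertonDyer.BirchSwinnertonDyer.Theorems.CMKolyvaginAtInertTwoCMExactDescentAtTwo
import HarnessLib

/-!
# Route `GenusKolyvaginAtTwo`, crux U₂ `MinimalTwinBSDTwo` (stmt-BirchSwinnertonDyer-22985), LINE 23 «twin_swap» (pen bsd-idea-1 g23):
# STUB S3 `SwappedPairDescentAtTwo` ON ITS METHOD SLICE — the `ε = −1` exact `2`-adic descent at depth zero, inside the genus budget,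
# PROVED in the kernel modulo the four published facts it consumes

Seat `bsd-line-gk2-p2` g23 (PROVER seat 2/3, cell `bsd-f1-sign2`), `--supports stmt-BirchSwinnertonDyer-22985` (helper; closes nothing).
THEOREMS ONLY (no definition, no named fact, no `sorry`).  **BSD is NOT proved by this file; U₂ / hTw / S3 AS TYPED are NOT proved;
no item is closed.**  CONDITIONAL (D-0014) on the four STATEMENT-ONLY published facts the route already carries as items: Gross–Zagier at
every level (`gross_zagier`, item `GrossZagierAllLevels` 24148), Gross–Zagier–Kolyvagin over `ℚ` (`rank_eq_analyticRank_of_analyticRank_le_one`),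
modularity (`hasEntireLFunction_rat`, item `EntireLFunctionRat` 19273) and Milne 1972 any-model (`Milne1972.bsdQuotient_baseChange_quadratic_anyModel`,
item `MilneAnyModel` 24149) — exactly the facts of the route's `ExactDescentAtTwoOfFourFacts` (24238, closed) and of the CM sibling's
`CMExactDescent.cmExactDescentAtTwo_of_facts`, whose `ε = −1` descent (rank-ONE Heegner member) this file re-runs.

THE SLICE (pen card `twin_swap.md` §Slice; REVFALS-g23).  S3 as typed (`SwappedPairDescentAtTwo`) takes ANY datum `Dt`, any `M₀` and a
Kolyvagin witness at some level; its method slice is: odd `Dt.c`, the `2`-Selmer-trivial twin inside the GENUS BUDGET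
`(Δ_E < 0 ∧ ord₂ C(Wd) ≤ 1) ∨ ord₂ C(Wd) = 0` (automatic at a prime Heegner discriminant on `Δ_E < 0`), and depth zero `y_K ∉ 2E(K[1])`
(the `n = 1` witness; REVFALS-g23: the Heegner index is odd on 41/41 odd-Tamagawa cells `N ≤ 250`).  On that slice:

* §1 **`swappedPairDescentAtTwo_depthZero_of_facts`** — `GZ → GZK → modularity → Milne →` for `W/ℚ` globally minimal with `r_an(E) = 1`,
  `#Sel₂(E) = 2`, `C(E)` odd; `K` imaginary quadratic, `d_K` odd `≠ −3`, Heegner for `N_E`; a datum `Dt` with `Dt.c` odd, `(β, ι)`, a conductor-`1`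
  Kolyvagin–Heegner datum `d₁` with `P(1)` of infinite order and **`P(1) ∉ 2E(K[1])`**; a globally minimal `Wd ≅ E^(d_K)` with `#Sel₂(Wd) = 1`
  inside the budget; then **`BSD₂(Wd) → BSD₂(E)`** (and `r_an(Wd) = 0` is a CONSEQUENCE, §1 `analyticRank_twist_eq_zero_of_rankOne`).
  Mechanism: (i) the swapped pair sandwich (sequel of `…SwappedPairSandwich`, UNCONDITIONAL) gives `Ш(E/K)[2^∞] = 0`, i.e. Kolyvagin
  EXACTNESS `#Ш(E/K)[2^∞] = 4^(M₀)` with `M₀ = 0` — no Kolyvagin prime, no Q2, no Čebotarev; (ii) the `ε = −1` exact descent of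
  `CMExactDescent` (Gross–Zagier V.§2 over `K` in Dokchitser–Dokchitser's currency: `P(1)` descends to `P₀ ∈ E(K)`; `E(K[1])[2] = 0` from
  `E(ℚ)[2] = 0` — here from `#Sel₂(E) = 2`, not from `ρ̄_{E,2}` onto; `ord₂[E(K):ℤP₀] = 0`; `#Ш_an(E_K) = 4I²/(c²·w_K²·C(E)²)` with
  `w_K = 2`, `c`, `C(E)` odd ⟹ `ord₂ #Ш_an(E_K) = 0 = ord₂ #Ш(E_K)`, i.e. `MissingPPartOverCAt (W ⊗ K) 2`; `L′(E/K,1) = L′(E,1)·L(E^(d_K),1) ≠ 0`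
  gives `r_an(Wd) = 0`; `AdditivePotMult.bsdp_of_pPartOverC_baseChange` concludes).
* §2 `swappedPairDescentAtTwo_depthZero_ofFacts` — the bundled `…OfFacts` shape.

CENSUS READING for LINE 23: S3′ := S3 cut to (odd `Dt.c`, budget, `n = 1` witness) is PRINT-COMPLETE (closed modulo the four facts); the
line's open content is S2′ (reversed supply WITH odd-Manin datum, budget-admissible `K` and a `2`-primitive `y_K`), S1 (the rank-`0` wall) and
S4.  Beyond print: no.  BSD is NOT proved; nothing is closed.

References: [GrossZagier1986] I.(6.3), V.§2; [GrossLMS1991] §1 (1.2), §2 (2.2), §4 (4.1), §5 Prop. 5.3; [Kolyvagin1990] Thm. A;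
[McCallumLMS1991] §5 Lemma 5.1; [Milne1972ArithmeticAV] §1 Thm. 1; [Kramer1981] Thm. 1; [Miller2011LMS] Def. 1.1.
-/

set_option autoImplicit false
set_option linter.dupNamespace false -- `Summit.<P>.<Sub>` repeats `BirchSwinnertonDyer` (D-0017)

noncomputable section

open scoped Classical

open WeierstrassCurve NumberField Literature.NumberTheory.EllipticCurves
  Literature.NumberTheory.EllipticCurves.ModularForms
  Literature.NumberTheory.EllipticCurves.Rank1Residual
  Literature.NumberTheory.EllipticCurves.Rank1Residual.Typed
  Literature.NumberTheory.EllipticCurves.KrizLi2019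
  Summit.BirchSwinnertonDyer.Rank1Residual
  Summit.BirchSwinnertonDyer.Rank1Residual.AdditivePotMult
  Summit.BirchSwinnertonDyer.BirchSwinnertonDyer.Theorems.CMExactDescent

namespace Summit.BirchSwinnertonDyer.BirchSwinnertonDyer.Theorems.GenusExact.TwinSwap

/-! ## §1 The `ε = −1` exact descent at depth zero on the budget slice -/

/-- **`E(K[1])[2^M] = 0` from `E(ℚ)[2] = 0`** for `W` globally minimal and a Heegner field `K` of odd discriminant (the CM sibling's
`eq_zero_of_two_pow_smul_eq_zero_ringClassField` with its `ρ̄_{E,2}`-onto binder replaced by its only use, no rational `2`-torsion: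
`Uniform.U2.RingClass.forall_two_nsmul_eq_zero_of_heegner`, induction on `M`). [cite: GrossLMS1991, §4 Lemma 4.3 (shape; here at p = 2)] -/
theorem eq_zero_of_two_pow_smul_eq_zero_ringClassField_of_noTwoTorsion
    (W : WeierstrassCurve ℚ) [W.IsElliptic] [W.IsGloballyMinimal] {K : Type} [Field K] [NumberField K] (hK : IsImaginaryQuadratic K)
    (hodd : Odd (NumberField.discr K)) (hH : SatisfiesHeegnerHypothesis (W.conductorNorm ℤ) K)
    (hT2 : ∀ P : W.toAffine.Point, 2 • P = 0 → P = 0)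
    (ι : K →+* ℂ) (M : ℕ) (R : (W.baseChange (ringClassField K ι 1)).toAffine.Point)
    (hR : ((2 ^ M : ℕ) : ℤ) • R = 0) : R = 0 := by
  haveI := (finiteDimensional_and_isGalois_ringClassField hK ι one_ne_zero).1
  haveI : NumberField (ringClassField K ι 1) := NumberField.of_module_finite K _
  have hD4 : NumberField.discr K % 4 = 1 :=
    Literature.NumberTheory.QuadraticFields.Quadratic.discr_emod_four_eq_one hK.1 hodd
  have h1 : ∀ Q : (W.baseChange (ringClassField K ι 1 : Type)).toAffine.Point, (2 : ℕ) • Q = 0 → Q = 0 :=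
    fun Q hQ ↦ Uniform.U2.RingClass.forall_two_nsmul_eq_zero_of_heegner W hK ι hD4 hH hT2 one_ne_zero Q hQ
  induction M generalizing R with
  | zero => simpa using hR
  | succ M ih =>
    have h2 : (2 : ℕ) • (((2 ^ M : ℕ) : ℤ) • R) = 0 := by
      rw [← natCast_zsmul, smul_smul, ← Nat.cast_mul, ← pow_succ', hR]
    exact ih R (h1 _ h2)

/-- **The twin of the rank-ONE member has analytic rank `0`** (`L′(E/K,1) = L′(E,1)·L(E^(d_K),1) ≠ 0`, Gross–Zagier + modularity).
[cite: GrossZagier1986, Thm. I.6.3 and V.§2] -/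
theorem analyticRank_twist_eq_zero_of_rankOne
    (W : WeierstrassCurve ℚ) [W.IsElliptic] [W.IsGloballyMinimal] [NeZero (W.conductorNorm ℤ)]
    (K : Type) [Field K] [NumberField K]
    (hGZ : gross_zagier (W.conductorNorm ℤ) W K) (hmod : hasEntireLFunction_rat)
    (hK : IsImaginaryQuadratic K) (hH : SatisfiesHeegnerHypothesis (W.conductorNorm ℤ) K)
    (hr : W.analyticRank = 1) {P₀ : (W.baseChange K).toAffine.Point}
    (hP₀ : IsHeegnerPoint (W.conductorNorm ℤ) W K P₀) (hPinf : ¬ IsOfFinAddOrder P₀) :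
    (W.quadraticTwist (NumberField.discr K : ℚ)).analyticRank = 0 := by
  have hD0 : (NumberField.discr K : ℚ) ≠ 0 := by exact_mod_cast NumberField.discr_ne_zero K
  haveI hEt : (W.quadraticTwist (NumberField.discr K : ℚ)).IsElliptic := W.isElliptic_quadraticTwist hD0
  have hLK : LDerivEK W K ≠ 0 := (lDerivEK_ne_zero_iff_not_isOfFinAddOrder W (W.conductorNorm ℤ) K hGZ hK hH hP₀).mpr hPinf
  have hL0 : W.entireLFunction 1 = 0 := entireLFunction_one_eq_zero_of_analyticRank_eq_one hr
  have hLt : (W.quadraticTwist (NumberField.discr K : ℚ)).entireLFunction 1 ≠ 0 := by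
    intro h0
    apply hLK
    rw [lDerivEK_eq_deriv_mul W K hmod hL0, h0, mul_zero]
  exact ((W.quadraticTwist _).analyticRank_eq_zero_iff_holds (hmod _)).mpr hLt

/-- **STUB S3 OF LINE 23 ON ITS METHOD SLICE — the swapped (`ε = −1`) exact `2`-adic descent at depth zero, MODULO ITS FOUR PUBLISHED
INPUTS** `hGZ` (Gross–Zagier, all `(N, W, K)`), `hGZK` (Gross–Zagier–Kolyvagin over `ℚ`), `hmod` (modularity), `hMilneC` (Milne any-model).
For the rank-ONE `2`-Selmer-minimal Heegner member `E` (`r_an(E) = 1`, `#Sel₂(E) = 2`, `C(E)` odd), a Heegner field `K` (`d_K` odd `≠ −3`),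
a datum with `Dt.c` odd, `P(1)` of infinite order and `2`-PRIMITIVE in `E(K[1])`, and a globally minimal `2`-Selmer-TRIVIAL twin `Wd ≅ E^(d_K)`
inside the genus budget: **`BSD₂(Wd) → BSD₂(E)`**.  Inside: `Ш(E/K)[2^∞] = 0` UNCONDITIONALLY (the swapped pair sandwich,
`natCard_primaryComponent_sha_baseChange_two_eq_one_of_swappedPair`; rank `E(ℚ) ≥ 1` from `P₀`), `E(K[1])[2] = 0` from `#Sel₂(E) = 2`,
`ord₂[E(K):ℤP₀] = 0`, `#Ш_an(E_K) = 4I²/(c²w_K²C(E)²)` of `2`-adic valuation `0`, so `MissingPPartOverCAt (W ⊗ K) 2`; `r_an(Wd) = 0`; then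
`AdditivePotMult.bsdp_of_pPartOverC_baseChange`.  CONDITIONAL on the four named facts (none has a `_holds`); closes nothing by itself.
[cite: GrossZagier1986, V.§2 (pp. 310–312)] [cite: GrossLMS1991, §5 Prop. 5.3] [cite: Milne1972ArithmeticAV, §1 Thm. 1]
[cite: McCallumLMS1991, §5 Lemma 5.1] [cite: Kramer1981, Thm. 1] [cite: Miller2011LMS, Def. 1.1] -/
theorem swappedPairDescentAtTwo_depthZero_of_facts
    (hGZ : ∀ (N : ℕ) [NeZero N] (W : WeierstrassCurve ℚ) (K : Type) [Field K] [NumberField K],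
      gross_zagier N W K)
    (hGZK : rank_eq_analyticRank_of_analyticRank_le_one) (hmod : hasEntireLFunction_rat)
    (hMilneC : Milne1972.bsdQuotient_baseChange_quadratic_anyModel) :
    ∀ (W : WeierstrassCurve ℚ) [W.IsElliptic] [W.IsGloballyMinimal] [NeZero (W.conductorNorm ℤ)],
      W.analyticRank = 1 → Nat.card (W.selmerGroup 2) = 2 → Odd W.tamagawaProduct →
      ∀ (K : Type) [Field K] [NumberField K], IsImaginaryQuadratic K → Odd (NumberField.discr K) →
      NumberField.discr K ≠ -3 → SatisfiesHeegnerHypothesis (W.conductorNorm ℤ) K →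
      ∀ (Dt : ModularParametrizationData W (W.conductorNorm ℤ)), Odd Dt.c →
      ∀ (β : ℤ) (ι : K →+* ℂ) (d₁ : KolyvaginHeegnerData Dt β ι 1), ¬ IsOfFinAddOrder d₁.derivedPoint →
        (¬ ∃ Q : (W.baseChange (ringClassField K ι 1)).toAffine.Point, (2 : ℤ) • Q = d₁.derivedPoint) →
      ∀ (Wd : WeierstrassCurve ℚ) [Wd.IsElliptic] [Wd.IsGloballyMinimal],
        (∃ C : WeierstrassCurve.VariableChange ℚ, C • W.quadraticTwist (NumberField.discr K : ℚ) = Wd) →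
        Nat.card (Wd.selmerGroup 2) = 1 →
        ((W.Δ < 0 ∧ padicValNat 2 Wd.tamagawaProduct ≤ 1) ∨ padicValNat 2 Wd.tamagawaProduct = 0) →
        BSDp Wd 2 → BSDp W 2 := by
  intro W _ _ _ hr hSel hT K _ _ hK hodd h3 hH Dt hc β ι d₁ hy hprim Wd _ _ hWd hSel1 hbudget hBd
  haveI : Fact (Nat.Prime 2) := ⟨Nat.prime_two⟩
  haveI hEK : (W.baseChange K).IsElliptic := isElliptic_baseChange' W K
  have h2 : Module.finrank ℚ K = 2 := hK.1
  have hD0 : (NumberField.discr K : ℚ) ≠ 0 := by exact_mod_cast NumberField.discr_ne_zero K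
  haveI hEt : (W.quadraticTwist (NumberField.discr K : ℚ)).IsElliptic := W.isElliptic_quadraticTwist hD0
  obtain ⟨hD4, hDlt⟩ := discr_emod_four_and_lt_of_odd hK hodd h3
  have hw2 : Units.torsionOrder K = 2 :=
    Literature.NumberTheory.QuadraticFields.Quadratic.torsionOrder_eq_two_of_discr_lt_neg_four h2 hDlt
  have hc0 : Dt.c ≠ 0 := by
    obtain ⟨k, hk⟩ := hc
    omega
  obtain ⟨Cd, hCd⟩ := hWd
  -- §2 (CM file): the Heegner point `P₀ ∈ E(K)` below `P(1)`, for the item's own `Dt`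
  obtain ⟨P₀, Hd, hP₀, hP₀K⟩ := exists_heegnerPoint_map_eq_derivedPoint_one hK hH d₁
  have hPinf : ¬ IsOfFinAddOrder P₀ := by
    intro hfin
    apply hy
    rw [← hP₀K]
    exact (WeierstrassCurve.Affine.Point.map (W' := W)
      (algebraMap K (ringClassField K ι 1)).toRatAlgHom).isOfFinAddOrder hfin
  -- ranks over `ℚ`: `rank E(K) ≥ 1`, `rank T₀(ℚ) = 0` (`#Sel₂ = 1`), hence `rank E(ℚ) ≥ 1`
  haveI : Module.Finite ℤ (W.baseChange K).toAffine.Point := (W.baseChange K).module_finite_point_holds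
  have hK1 : 1 ≤ (W.baseChange K).mordellWeilRank :=
    Literature.NumberTheory.EllipticCurves.one_le_mordellWeilRank_of_not_isOfFinAddOrder (W.baseChange K) inferInstance hPinf
  have hSelT : Nat.card ((W.quadraticTwist (NumberField.discr K : ℚ)).selmerGroup ((2 : ℕ) : ℤ)) = 1 := by
    have h := natCard_selmerGroup_smul (W.quadraticTwist (NumberField.discr K : ℚ)) Cd (n := 2) two_ne_zero
    rw [hCd] at h
    rw [← h, Nat.cast_ofNat]
    exact hSel1
  obtain ⟨hrkT0, -, -⟩ := rank_eq_zero_and_torsionBy_eq_bot_and_sha_inf_torsionBy_eq_bot_of_natCard_selmerGroup_eq_one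
    (W.quadraticTwist (NumberField.discr K : ℚ)) 2 hSelT
  have hrk : 1 ≤ W.mordellWeilRank := by
    have hsum := W.mordellWeilRank_baseChange_of_finrank_eq_two_of_finite K h2
    rw [hrkT0, add_zero] at hsum
    rw [← hsum]
    exact hK1
  -- (i) THE SWAPPED PAIR SANDWICH: `Ш(E/K)[2^∞] = 0`, unconditionally
  obtain ⟨hfinSha, hsha⟩ := natCard_primaryComponent_sha_baseChange_two_eq_one_of_swappedPair W K hT hK hodd hH hrk hSel Cd hCd
    hSel1 hbudget
  -- `E(ℚ)[2] = 0` (descent count), hence `E(K[1])[2^M] = 0` and `E(K)[2] = 0`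
  obtain ⟨-, hT2, -⟩ := rank_eq_one_and_sha_primary_eq_zero_of_natCard_selmerGroup_eq_two W hSel hrk
  have hT2' : ∀ P : W.toAffine.Point, 2 • P = 0 → P = 0 := fun P hP ↦ by convert hT2 P (by convert hP)
  have htor1 : ∀ (M : ℕ) (R : (W.baseChange (ringClassField K ι 1)).toAffine.Point),
      ((2 ^ M : ℕ) : ℤ) • R = 0 → R = 0 :=
    fun M R hR ↦ eq_zero_of_two_pow_smul_eq_zero_ringClassField_of_noTwoTorsion W hK hodd hH hT2' ι M R hR
  have hiv : ∀ x : (W.baseChange K).toAffine.Point, 2 • x = 0 → x = 0 := fun x hx ↦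
    forall_two_zsmul_baseChange_eq_zero_of_heegner W K hK hodd hH hT2' x (by rw [← natCast_zsmul] at hx; exact_mod_cast hx)
  -- the twin has analytic rank `0`; `E_K` has analytic rank `1`
  have hrt : (W.quadraticTwist (NumberField.discr K : ℚ)).analyticRank = 0 :=
    analyticRank_twist_eq_zero_of_rankOne W K (hGZ _ W K) hmod hK hH hr ⟨Dt, Hd, ι, hP₀⟩ hPinf
  have hrd : Wd.analyticRank = 0 := by rw [← hCd, analyticRank_smul, hrt]
  have hrK : (W.baseChange K).analyticRank = 1 :=
    (P2.analyticRank_baseChange_eq_one_iff W K hmod h2).mpr (Or.inl ⟨hr, hrt⟩)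
  -- §4 (CM file): the exact identity over `K`
  obtain ⟨hrkK, hShaK, -, hshaC⟩ := shaAnOverC_baseChange_eq_of_heegner W K Dt Hd ι P₀ (hGZ _ W K)
    hGZK hmod hK hH hP₀ hc0 hrK
  haveI hfinK : Finite (W.baseChange K).sha := hShaK
  -- §3: `ord₂ [E(K) : ℤP₀] = 0` (depth zero: `P(1) ∉ 2E(K[1])`)
  have hdivK : ∃ Q : (W.baseChange K).toAffine.Point, ((2 ^ 0 : ℕ) : ℤ) • Q = P₀ := ⟨P₀, by rw [pow_zero, Nat.cast_one, one_zsmul]⟩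
  have hndivK : ¬ ∃ Q : (W.baseChange K).toAffine.Point, ((2 ^ (0 + 1) : ℕ) : ℤ) • Q = P₀ := by
    intro h
    have h' := (X11b.Three.Koly.pDiv_one_iff_exists_zsmul_eq hK d₁ P₀ hP₀K 2 (0 + 1) (htor1 (0 + 1))).mpr h
    exact hprim (by simpa [X11b.Three.Koly.PDiv] using h')
  haveI : Finite (AddCommGroup.torsion (W.baseChange K).toAffine.Point) :=
    WeierstrassCurve.finite_torsion_point (W := W.baseChange K)
  obtain ⟨cc, Q, hcQ, hcker⟩ := X11b.RankOne.exists_coord_of_mordellWeilRank_eq_one (W.baseChange K) hrkK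
  have hidx : padicValNat 2 (AddSubgroup.zmultiples P₀).index = 0 :=
    X11b.Three.Koly.padicValNat_index_zmultiples_eq_of_divisibility (p := 2) cc Q hcQ hcker hiv P₀ hdivK hndivK
  -- §5: `ord₂ #Ш_an(W ⊗ K) = 0 = ord₂ #Ш(W ⊗ K)`
  set I := (AddSubgroup.zmultiples P₀).index with hI_def
  have hI0 : I ≠ 0 := fun hI ↦ by
    have hh := P2.torsionOrder_sq_mul_canonicalHeight_eq_index_sq_mul_regulator (W.baseChange K) hrkK P₀ hPinf
    rw [← hI_def, hI, Nat.cast_zero, zero_pow two_ne_zero, zero_mul, mul_eq_zero, pow_eq_zero_iff two_ne_zero,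
      Nat.cast_eq_zero] at hh
    exact hh.elim (W.baseChange K).torsionOrder_pos_holds.ne'
      (fun h0 ↦ hPinf ((Affine.Point.canonicalHeight_eq_zero_iff_holds P₀).mp h0))
  set q : ℚ := 4 * (I : ℚ) ^ 2 /
      ((Dt.c : ℚ) ^ 2 * (Units.torsionOrder K : ℚ) ^ 2 * ((W.tamagawaProduct : ℚ) ^ 2)) with hq_def
  have hcQ0 : (Dt.c : ℚ) ≠ 0 := by exact_mod_cast hc0
  have hcW0 : (W.tamagawaProduct : ℚ) ≠ 0 := by exact_mod_cast W.tamagawaProduct_pos_holds.ne'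
  have hIQ0 : (I : ℚ) ≠ 0 := by exact_mod_cast hI0
  have hq' : q = ((I : ℚ) / ((Dt.c : ℚ) * (W.tamagawaProduct : ℚ))) ^ 2 := by
    rw [hq_def, hw2]
    push_cast
    field_simp
    ring
  have hvc : padicValRat 2 (Dt.c : ℚ) = 0 := by
    rw [padicValRat.of_int, padicValInt.eq_zero_of_not_dvd (fun h2c ↦
      (Int.not_even_iff_odd.mpr hc) (even_iff_two_dvd.mpr h2c))]
    rfl
  have hvcW : padicValRat 2 (W.tamagawaProduct : ℚ) = 0 := by
    rw [padicValRat.of_nat, padicValNat.eq_zero_of_not_dvd hT.not_two_dvd_nat]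
    rfl
  have hval : padicValRat 2 q = 2 * ((0 : ℕ) : ℤ) := by
    rw [hq', padicValRat.pow, padicValRat.div hIQ0 (mul_ne_zero hcQ0 hcW0),
      padicValRat.mul hcQ0 hcW0, hvc, hvcW, padicValRat.of_nat, hidx]
    push_cast
  have hshaV : padicValNat 2 (W.baseChange K).shaOrder = 2 * 0 := by
    rw [X11b.Three.Koly.padicValNat_shaOrder_eq (W.baseChange K) 2, hsha]
    simp
  have hKin : MissingPPartOverCAt (W.baseChange K) 2 := ⟨q, hshaC, by rw [hval, hshaV]; simp⟩
  exact bsdp_of_pPartOverC_baseChange W 2 K Wd hGZK hmod hMilneC hr.le h2 ⟨Cd, hCd⟩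
    (by rw [hrd]; exact zero_le_one) hKin hBd

/-! ## §2 The bundled `…OfFacts` shape -/

/-- **S3 on its method slice RELATIVE TO its named-fact bundle** (the cell's `…OfFacts` shape, as for `ExactDescentAtTwoOfFourFacts` 24238 and
the CM sibling 22837): `(∀ N W K, gross_zagier N W K) ∧ GZK ∧ modularity ∧ Milne any-model →` the depth-zero swapped descent.
[cite: Miller2011LMS, Def. 1.1] -/
theorem swappedPairDescentAtTwo_depthZero_ofFacts :
    ((∀ (N : ℕ) [NeZero N] (W : WeierstrassCurve ℚ) (K : Type) [Field K] [NumberField K],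
        gross_zagier N W K) ∧
      rank_eq_analyticRank_of_analyticRank_le_one ∧ hasEntireLFunction_rat ∧
      Milne1972.bsdQuotient_baseChange_quadratic_anyModel) →
    ∀ (W : WeierstrassCurve ℚ) [W.IsElliptic] [W.IsGloballyMinimal] [NeZero (W.conductorNorm ℤ)],
      W.analyticRank = 1 → Nat.card (W.selmerGroup 2) = 2 → Odd W.tamagawaProduct →
      ∀ (K : Type) [Field K] [NumberField K], IsImaginaryQuadratic K → Odd (NumberField.discr K) →
      NumberField.discr K ≠ -3 → SatisfiesHeegnerHypothesis (W.conductorNorm ℤ) K →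
      ∀ (Dt : ModularParametrizationData W (W.conductorNorm ℤ)), Odd Dt.c →
      ∀ (β : ℤ) (ι : K →+* ℂ) (d₁ : KolyvaginHeegnerData Dt β ι 1), ¬ IsOfFinAddOrder d₁.derivedPoint →
        (¬ ∃ Q : (W.baseChange (ringClassField K ι 1)).toAffine.Point, (2 : ℤ) • Q = d₁.derivedPoint) →
      ∀ (Wd : WeierstrassCurve ℚ) [Wd.IsElliptic] [Wd.IsGloballyMinimal],
        (∃ C : WeierstrassCurve.VariableChange ℚ, C • W.quadraticTwist (NumberField.discr K : ℚ) = Wd) →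
        Nat.card (Wd.selmerGroup 2) = 1 →
        ((W.Δ < 0 ∧ padicValNat 2 Wd.tamagawaProduct ≤ 1) ∨ padicValNat 2 Wd.tamagawaProduct = 0) →
        BSDp Wd 2 → BSDp W 2 :=
  fun h ↦ swappedPairDescentAtTwo_depthZero_of_facts h.1 h.2.1 h.2.2.1 h.2.2.2

/-! ## §3 (append) The MANIN-FREE form: exact exponent `ord₂[E(K[1]) : P(1)] = ord₂ c` instead of `c` odd and `P(1)` primitive -/

/-- **STUB S3 ON ITS METHOD SLICE, MANIN-FREE (S3″).**  Same frame as `swappedPairDescentAtTwo_depthZero_of_facts`, but for ANY datum `Dt`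
(`Dt.c ≠ 0`, no parity condition) and the exponent clause **`2^(M₀) ∣ P(1)`, `2^(M₀+1) ∤ P(1)` in `E(K[1])` with `M₀ = ord₂ Dt.c`**:
`GZ → GZK → modularity → Milne → … → BSD₂(Wd) → BSD₂(E)`.  Rationale: the Gross–Zagier bookkeeping over `K` reads `#Ш_an(E_K) =
4I²/(c²·w_K²·C(E)²)` with `ord₂ I = M₀` (McCallum 5.1), so `ord₂ #Ш_an(E_K) = 2(M₀ − ord₂ c) = 0 = ord₂ #Ш(E_K)` (the swapped sandwich);
the parity of the Manin constant never enters — replacing `Dt` by a datum with constant `2c` doubles `P(1)` and raises `M₀` by one, and the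
clause `M₀ = ord₂ c` is invariant.  This frees LINE 23's supply stub from the Manin constant of the rank-one curve (open when `4 ∣ N`):
S2″ := S2′ with «`Odd Dt.c ∧ P(1) ∉ 2E(K[1])`» replaced by «`Dt.c ≠ 0 ∧ ord₂`-exponent of `P(1)` in `E(K[1])` `= ord₂ Dt.c`» (BSD-predicted
inside the budget, hence lossless).  CONDITIONAL on the four named facts; closes nothing by itself.
[cite: GrossZagier1986, V.§2 (pp. 310–312)] [cite: GrossLMS1991, §5 Prop. 5.3] [cite: Milne1972ArithmeticAV, §1 Thm. 1]
[cite: McCallumLMS1991, §5 Lemma 5.1] [cite: Kramer1981, Thm. 1] [cite: Miller2011LMS, Def. 1.1] -/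
theorem swappedPairDescentAtTwo_maninExponent_of_facts
    (hGZ : ∀ (N : ℕ) [NeZero N] (W : WeierstrassCurve ℚ) (K : Type) [Field K] [NumberField K],
      gross_zagier N W K)
    (hGZK : rank_eq_analyticRank_of_analyticRank_le_one) (hmod : hasEntireLFunction_rat)
    (hMilneC : Milne1972.bsdQuotient_baseChange_quadratic_anyModel) :
    ∀ (W : WeierstrassCurve ℚ) [W.IsElliptic] [W.IsGloballyMinimal] [NeZero (W.conductorNorm ℤ)],
      W.analyticRank = 1 → Nat.card (W.selmerGroup 2) = 2 → Odd W.tamagawaProduct →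
      ∀ (K : Type) [Field K] [NumberField K], IsImaginaryQuadratic K → Odd (NumberField.discr K) →
      NumberField.discr K ≠ -3 → SatisfiesHeegnerHypothesis (W.conductorNorm ℤ) K →
      ∀ (Dt : ModularParametrizationData W (W.conductorNorm ℤ)), Dt.c ≠ 0 →
      ∀ (β : ℤ) (ι : K →+* ℂ) (d₁ : KolyvaginHeegnerData Dt β ι 1), ¬ IsOfFinAddOrder d₁.derivedPoint →
      ∀ (M₀ : ℕ), padicValInt 2 Dt.c = M₀ →
        (∃ Q : (W.baseChange (ringClassField K ι 1)).toAffine.Point, ((2 ^ M₀ : ℕ) : ℤ) • Q = d₁.derivedPoint) →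
        (¬ ∃ Q : (W.baseChange (ringClassField K ι 1)).toAffine.Point, ((2 ^ (M₀ + 1) : ℕ) : ℤ) • Q = d₁.derivedPoint) →
      ∀ (Wd : WeierstrassCurve ℚ) [Wd.IsElliptic] [Wd.IsGloballyMinimal],
        (∃ C : WeierstrassCurve.VariableChange ℚ, C • W.quadraticTwist (NumberField.discr K : ℚ) = Wd) →
        Nat.card (Wd.selmerGroup 2) = 1 →
        ((W.Δ < 0 ∧ padicValNat 2 Wd.tamagawaProduct ≤ 1) ∨ padicValNat 2 Wd.tamagawaProduct = 0) →
        BSDp Wd 2 → BSDp W 2 := by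
  intro W _ _ _ hr hSel hT K _ _ hK hodd h3 hH Dt hc0 β ι d₁ hy M₀ hcM hdiv hndiv Wd _ _ hWd hSel1 hbudget hBd
  haveI : Fact (Nat.Prime 2) := ⟨Nat.prime_two⟩
  haveI hEK : (W.baseChange K).IsElliptic := isElliptic_baseChange' W K
  have h2 : Module.finrank ℚ K = 2 := hK.1
  have hD0 : (NumberField.discr K : ℚ) ≠ 0 := by exact_mod_cast NumberField.discr_ne_zero K
  haveI hEt : (W.quadraticTwist (NumberField.discr K : ℚ)).IsElliptic := W.isElliptic_quadraticTwist hD0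
  obtain ⟨hD4, hDlt⟩ := discr_emod_four_and_lt_of_odd hK hodd h3
  have hw2 : Units.torsionOrder K = 2 :=
    Literature.NumberTheory.QuadraticFields.Quadratic.torsionOrder_eq_two_of_discr_lt_neg_four h2 hDlt
  obtain ⟨Cd, hCd⟩ := hWd
  -- the Heegner point `P₀ ∈ E(K)` below `P(1)`
  obtain ⟨P₀, Hd, hP₀, hP₀K⟩ := exists_heegnerPoint_map_eq_derivedPoint_one hK hH d₁
  have hPinf : ¬ IsOfFinAddOrder P₀ := by
    intro hfin
    apply hy
    rw [← hP₀K]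
    exact (WeierstrassCurve.Affine.Point.map (W' := W)
      (algebraMap K (ringClassField K ι 1)).toRatAlgHom).isOfFinAddOrder hfin
  -- ranks over `ℚ`
  haveI : Module.Finite ℤ (W.baseChange K).toAffine.Point := (W.baseChange K).module_finite_point_holds
  have hK1 : 1 ≤ (W.baseChange K).mordellWeilRank :=
    Literature.NumberTheory.EllipticCurves.one_le_mordellWeilRank_of_not_isOfFinAddOrder (W.baseChange K) inferInstance hPinf
  have hSelT : Nat.card ((W.quadraticTwist (NumberField.discr K : ℚ)).selmerGroup ((2 : ℕ) : ℤ)) = 1 := by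
    have h := natCard_selmerGroup_smul (W.quadraticTwist (NumberField.discr K : ℚ)) Cd (n := 2) two_ne_zero
    rw [hCd] at h
    rw [← h, Nat.cast_ofNat]
    exact hSel1
  obtain ⟨hrkT0, -, -⟩ := rank_eq_zero_and_torsionBy_eq_bot_and_sha_inf_torsionBy_eq_bot_of_natCard_selmerGroup_eq_one
    (W.quadraticTwist (NumberField.discr K : ℚ)) 2 hSelT
  have hrk : 1 ≤ W.mordellWeilRank := by
    have hsum := W.mordellWeilRank_baseChange_of_finrank_eq_two_of_finite K h2
    rw [hrkT0, add_zero] at hsum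
    rw [← hsum]
    exact hK1
  -- the swapped pair sandwich: `Ш(E/K)[2^∞] = 0`, unconditionally
  obtain ⟨-, hsha⟩ := natCard_primaryComponent_sha_baseChange_two_eq_one_of_swappedPair W K hT hK hodd hH hrk hSel Cd hCd
    hSel1 hbudget
  -- no `2`-torsion over `K[1]` and over `K`
  obtain ⟨-, hT2, -⟩ := rank_eq_one_and_sha_primary_eq_zero_of_natCard_selmerGroup_eq_two W hSel hrk
  have hT2' : ∀ P : W.toAffine.Point, 2 • P = 0 → P = 0 := fun P hP ↦ by convert hT2 P (by convert hP)
  have htor1 : ∀ (M : ℕ) (R : (W.baseChange (ringClassField K ι 1)).toAffine.Point),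
      ((2 ^ M : ℕ) : ℤ) • R = 0 → R = 0 :=
    fun M R hR ↦ eq_zero_of_two_pow_smul_eq_zero_ringClassField_of_noTwoTorsion W hK hodd hH hT2' ι M R hR
  have hiv : ∀ x : (W.baseChange K).toAffine.Point, 2 • x = 0 → x = 0 := fun x hx ↦
    forall_two_zsmul_baseChange_eq_zero_of_heegner W K hK hodd hH hT2' x (by rw [← natCast_zsmul] at hx; exact_mod_cast hx)
  -- analytic ranks
  have hrt : (W.quadraticTwist (NumberField.discr K : ℚ)).analyticRank = 0 :=
    analyticRank_twist_eq_zero_of_rankOne W K (hGZ _ W K) hmod hK hH hr ⟨Dt, Hd, ι, hP₀⟩ hPinf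
  have hrd : Wd.analyticRank = 0 := by rw [← hCd, analyticRank_smul, hrt]
  have hrK : (W.baseChange K).analyticRank = 1 :=
    (P2.analyticRank_baseChange_eq_one_iff W K hmod h2).mpr (Or.inl ⟨hr, hrt⟩)
  -- Gross–Zagier over `K`
  obtain ⟨hrkK, hShaK, -, hshaC⟩ := shaAnOverC_baseChange_eq_of_heegner W K Dt Hd ι P₀ (hGZ _ W K)
    hGZK hmod hK hH hP₀ hc0 hrK
  haveI hfinK : Finite (W.baseChange K).sha := hShaK
  -- `ord₂ [E(K) : ℤP₀] = M₀`
  have hdivK : ∃ Q : (W.baseChange K).toAffine.Point, ((2 ^ M₀ : ℕ) : ℤ) • Q = P₀ :=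
    (X11b.Three.Koly.pDiv_one_iff_exists_zsmul_eq hK d₁ P₀ hP₀K 2 M₀ (htor1 M₀)).mp hdiv
  have hndivK : ¬ ∃ Q : (W.baseChange K).toAffine.Point, ((2 ^ (M₀ + 1) : ℕ) : ℤ) • Q = P₀ :=
    fun h ↦ hndiv ((X11b.Three.Koly.pDiv_one_iff_exists_zsmul_eq hK d₁ P₀ hP₀K 2 (M₀ + 1) (htor1 (M₀ + 1))).mpr h)
  haveI : Finite (AddCommGroup.torsion (W.baseChange K).toAffine.Point) :=
    WeierstrassCurve.finite_torsion_point (W := W.baseChange K)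
  obtain ⟨cc, Q, hcQ, hcker⟩ := X11b.RankOne.exists_coord_of_mordellWeilRank_eq_one (W.baseChange K) hrkK
  have hidx : padicValNat 2 (AddSubgroup.zmultiples P₀).index = M₀ :=
    X11b.Three.Koly.padicValNat_index_zmultiples_eq_of_divisibility (p := 2) cc Q hcQ hcker hiv P₀ hdivK hndivK
  -- `ord₂ #Ш_an(W ⊗ K) = 2 M₀ − 2 ord₂ c = 0 = ord₂ #Ш(W ⊗ K)`
  set I := (AddSubgroup.zmultiples P₀).index with hI_def
  have hI0 : I ≠ 0 := fun hI ↦ by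
    have hh := P2.torsionOrder_sq_mul_canonicalHeight_eq_index_sq_mul_regulator (W.baseChange K) hrkK P₀ hPinf
    rw [← hI_def, hI, Nat.cast_zero, zero_pow two_ne_zero, zero_mul, mul_eq_zero, pow_eq_zero_iff two_ne_zero,
      Nat.cast_eq_zero] at hh
    exact hh.elim (W.baseChange K).torsionOrder_pos_holds.ne'
      (fun h0 ↦ hPinf ((Affine.Point.canonicalHeight_eq_zero_iff_holds P₀).mp h0))
  set q : ℚ := 4 * (I : ℚ) ^ 2 /
      ((Dt.c : ℚ) ^ 2 * (Units.torsionOrder K : ℚ) ^ 2 * ((W.tamagawaProduct : ℚ) ^ 2)) with hq_def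
  have hcQ0 : (Dt.c : ℚ) ≠ 0 := by exact_mod_cast hc0
  have hcW0 : (W.tamagawaProduct : ℚ) ≠ 0 := by exact_mod_cast W.tamagawaProduct_pos_holds.ne'
  have hIQ0 : (I : ℚ) ≠ 0 := by exact_mod_cast hI0
  have hq' : q = ((I : ℚ) / ((Dt.c : ℚ) * (W.tamagawaProduct : ℚ))) ^ 2 := by
    rw [hq_def, hw2]
    push_cast
    field_simp
    ring
  have hvc : padicValRat 2 (Dt.c : ℚ) = (M₀ : ℤ) := by
    rw [padicValRat.of_int, hcM]
  have hvcW : padicValRat 2 (W.tamagawaProduct : ℚ) = 0 := by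
    rw [padicValRat.of_nat, padicValNat.eq_zero_of_not_dvd hT.not_two_dvd_nat]
    rfl
  have hval : padicValRat 2 q = 0 := by
    rw [hq', padicValRat.pow, padicValRat.div hIQ0 (mul_ne_zero hcQ0 hcW0),
      padicValRat.mul hcQ0 hcW0, hvc, hvcW, padicValRat.of_nat, hidx]
    push_cast
    ring
  have hshaV : padicValNat 2 (W.baseChange K).shaOrder = 0 := by
    rw [X11b.Three.Koly.padicValNat_shaOrder_eq (W.baseChange K) 2, hsha]
    simp
  have hKin : MissingPPartOverCAt (W.baseChange K) 2 := ⟨q, hshaC, by rw [hval, hshaV]; simp⟩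
  exact bsdp_of_pPartOverC_baseChange W 2 K Wd hGZK hmod hMilneC hr.le h2 ⟨Cd, hCd⟩
    (by rw [hrd]; exact zero_le_one) hKin hBd

end Summit.BirchSwinnertonDyer.BirchSwinnertonDyer.Theorems.GenusExact.TwinSwap

end
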